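import Summits.AtomisticToContinuum.BoseEinsteinCondensation.Theorems.FibreConductance.Negative.TestFunction

/-!
# Crux `FibreConductance` — the exact-minimiser hypothesis (H1) is load-bearing

* `FibreBoundAt`, `FibreConductanceWith`, `fibreConductance_iff` (the crux verbatim, `Iff.rfl`);
* `FibreConductanceNearMinimiser` ((H1) relaxed to `periodicEnergy v Φ ≤ E₀ + δ`, the slack `δ > 0`
  at the claimant's disposal after `v, M`) and `FibreConductanceWithoutMinimiser` ((H1) dropped),
  with the implications Without ⇒ Near ⇒ crux;
* **`not_fibreConductanceNearMinimiser`**: FALSE for every slack — witness `v = 0`, the ultra-dilute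
  corner `L = M²N/4π²`, `n = e₀`, the two-slab product state (excess energy `16384π⁶K²/(M⁴N) → 0`,
  `β₀ = 0`), Thomson duality with `η = f(x₀₀)∏φ(xⱼ)²`: every admissible flow costs
  `≥ L²/(16384π²K²σ²) > C L²` for `σ` small; corollary `not_fibreConductanceWithoutMinimiser`.

Reading for the route: the fibre bound is a property of the EXACT ground state only; (H1) must enter
through the Euler–Lagrange equation / Harnack comparability of `Ψ₀`, never through energy
closeness; downstream users (GDCan for all `Φ`, GDTransfer's near-minimisers) may invoke the crux
only at `Ψ₀`.

Crux disprover file for `stmt-AtomisticToContinuum-9480` (route `BECThomsonPrinciple`, crux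
`FibreConductance`); part of the chain `Profiles → OneDimAxis → (FibreVocabulary) → SlabState →
TestFunction → NearMinimiserFalse` proving `not_fibreConductanceNearMinimiser`: the exact-minimiser
hypothesis (H1) of the crux cannot be relaxed to `δ`-near-minimality for any `δ > 0`.
All [folklore] (elementary real analysis).
-/

noncomputable section

namespace Summit.AtomisticToContinuum.BoseEinsteinCondensation.Theorems.FibreConductance.Negative

open MeasureTheory Literature.MathematicalPhysics.QuantumManyBody.BoseGas
open scoped ENNReal NNReal

section Main

open Real
open Summit.AtomisticToContinuum.BoseEinsteinCondensation.Theorems.GaussianDominationCan.Negative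

variable {m : ℕ} {L σ : ℝ}

/-! #### The statements -/

/-- The crux's conclusion at fixed data `(L, n, Φ, C)`. -/
def FibreBoundAt (L : ℝ) (n : Fin 3 → ℤ) (Φ : PeriodicTrialState (m + 1) L) (C : ℝ) : Prop :=
  ∃ J : Config (m + 1) → Fin 3 → ℂ, IsFibreFlow m L (fibreCharge L n Φ.ψ) J ∧
    fibreCost L Φ.ψ J ≤ ENNReal.ofReal (C * L ^ 2 / ‖(fun j => (n j : ℝ))‖ ^ 2)

/-- The crux with its constants exposed, for fixed `v`, `M`. -/
def FibreConductanceWith (ρ₀ C : ℝ) (N₀ : ℕ) (v : ℝ → ℝ≥0∞) (M : ℝ) : Prop :=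
  ∀ m : ℕ, N₀ ≤ m + 1 → ∀ L : ℝ, 0 < L → ((m + 1 : ℕ) : ℝ) ≤ ρ₀ * L ^ 3 →
    ∀ n : Fin 3 → ℤ, n ≠ 0 → InWindow M m L n →
      ∀ Φ : PeriodicTrialState (m + 1) L,
        periodicEnergy v Φ = periodicGroundStateEnergy v (m + 1) L → (∀ X, Φ.ψ X ≠ 0) →
          FibreBoundAt L n Φ C

/-- **The crux, verbatim, in named vocabulary** (definitional unfolding only). [folklore] -/
theorem fibreConductance_iff :
    Summit.AtomisticToContinuum.BoseEinsteinCondensation.Theses.BECThomsonPrinciple.FibreConductance ↔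
      ∀ v : ℝ → ℝ≥0∞, IsRepulsiveFiniteRange v → (∃ B : ℝ, ∀ r, v r ≤ ENNReal.ofReal B) →
        ∀ M : ℝ, 0 < M → ∃ ρ₀ C : ℝ, 0 < ρ₀ ∧ 0 < C ∧ ∃ N₀ : ℕ, FibreConductanceWith ρ₀ C N₀ v M :=
  Iff.rfl

/-- **(H1) relaxed to near-minimality.** The crux with `periodicEnergy v Φ = E₀` replaced by
`periodicEnergy v Φ ≤ E₀ + δ`, the slack `δ > 0` being at the disposal of the claimant together with
`ρ₀, C, N₀` (the weakest near-minimiser form of the crux). -/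
def FibreConductanceNearMinimiser : Prop :=
  ∀ v : ℝ → ℝ≥0∞, IsRepulsiveFiniteRange v → (∃ B : ℝ, ∀ r, v r ≤ ENNReal.ofReal B) →
    ∀ M : ℝ, 0 < M → ∃ ρ₀ C : ℝ, 0 < ρ₀ ∧ 0 < C ∧ ∃ N₀ : ℕ, ∃ δ : ℝ≥0∞, 0 < δ ∧
      ∀ m : ℕ, N₀ ≤ m + 1 → ∀ L : ℝ, 0 < L → ((m + 1 : ℕ) : ℝ) ≤ ρ₀ * L ^ 3 →
        ∀ n : Fin 3 → ℤ, n ≠ 0 → InWindow M m L n →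
          ∀ Φ : PeriodicTrialState (m + 1) L,
            periodicEnergy v Φ ≤ periodicGroundStateEnergy v (m + 1) L + δ → (∀ X, Φ.ψ X ≠ 0) →
              FibreBoundAt L n Φ C

/-- **(H1) dropped.** The crux for all zero-free admissible states. -/
def FibreConductanceWithoutMinimiser : Prop :=
  ∀ v : ℝ → ℝ≥0∞, IsRepulsiveFiniteRange v → (∃ B : ℝ, ∀ r, v r ≤ ENNReal.ofReal B) →
    ∀ M : ℝ, 0 < M → ∃ ρ₀ C : ℝ, 0 < ρ₀ ∧ 0 < C ∧ ∃ N₀ : ℕ,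
      ∀ m : ℕ, N₀ ≤ m + 1 → ∀ L : ℝ, 0 < L → ((m + 1 : ℕ) : ℝ) ≤ ρ₀ * L ^ 3 →
        ∀ n : Fin 3 → ℤ, n ≠ 0 → InWindow M m L n →
          ∀ Φ : PeriodicTrialState (m + 1) L, (∀ X, Φ.ψ X ≠ 0) → FibreBoundAt L n Φ C

/-- Dropping (H1) is stronger than relaxing it. [folklore] -/
theorem fibreConductanceNearMinimiser_of_without (h : FibreConductanceWithoutMinimiser) :
    FibreConductanceNearMinimiser := by
  intro v hv hB M hM
  obtain ⟨ρ₀, C, hρ, hC, N₀, hmain⟩ := h v hv hB M hM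
  exact ⟨ρ₀, C, hρ, hC, N₀, 1, one_pos, fun m hm L hL hd n hn hw Φ _ hz => hmain m hm L hL hd n hn hw Φ hz⟩

/-- Relaxing (H1) is stronger than the crux. [folklore] -/
theorem fibreConductance_of_nearMinimiser (h : FibreConductanceNearMinimiser) :
    Summit.AtomisticToContinuum.BoseEinsteinCondensation.Theses.BECThomsonPrinciple.FibreConductance := by
  rw [fibreConductance_iff]
  intro v hv hB M hM
  obtain ⟨ρ₀, C, hρ, hC, N₀, δ, _, hmain⟩ := h v hv hB M hM
  exact ⟨ρ₀, C, hρ, hC, N₀, fun m hm L hL hd n hn hw Φ hE hz =>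
    hmain m hm L hL hd n hn hw Φ (hE ▸ le_self_add) hz⟩

/-- **MAIN NEGATIVE RESULT (cycle 2).** The exact-minimiser hypothesis (H1) of `FibreConductance`
cannot be relaxed to `δ`-near-minimality for ANY slack `δ > 0`, even one chosen after `v` and `M`:
for the free gas `v = 0` (admissible, bounded), at the ultra-dilute corner `L = M²N/4π²`, `n = e₀`
of the parameter window, the two-slab product state `Φ = φ^{⊗N}` (`φ = g(y₀)/√Z`, `g = σ` on the
two barriers `{|sin 2πy₀/L| ≤ 1/2}`, `g = 1` on the chambers) is zero-free, has excess energy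
`≤ N·1024π²K²/L² = O(1/N) → 0` (so it is `δ`-near-minimal for `N` large), its fibre charge is
`L^{-3/2} e₀(x₀)φ(x₀)` (`β₀ = 0` by `L/2`-periodicity), and Thomson duality with the test function
`η = f(x₀₀)∏_{j≠0}φ(xⱼ)²` (`f` = chamber selector, varying only inside the barriers) gives every
admissible flow the cost `≥ L²/(16384 π²K²σ²)`, which beats `C L²` for `σ` small. [folklore] -/
theorem not_fibreConductanceNearMinimiser : ¬ FibreConductanceNearMinimiser := by
  intro h
  obtain ⟨K, hK1, hK⟩ := exists_bound_deriv_smoothTransition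
  have hK0 : 0 < K := by linarith
  obtain ⟨ρ₀, C, hρ, hC, N₀, δ, hδ, hmain⟩ :=
    h 0 isRepulsiveFiniteRange_zero ⟨0, fun r => by simp⟩ 1 one_pos
  -- choice of `N`
  set T₂ : ℝ := if δ = ⊤ then 0 else 16384 * π ^ 6 * K ^ 2 / δ.toReal with hT₂
  obtain ⟨m, hmN, hmT⟩ := exists_large N₀ (max (64 * π ^ 6 / (ρ₀ * 1 ^ 6)) T₂)
  obtain ⟨hL, hdens, hwin⟩ := corner one_pos hρ m ((le_max_left _ _).trans hmT)
  set L : ℝ := 1 ^ 2 * ((m + 1 : ℕ) : ℝ) / (4 * π ^ 2) with hLdef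
  set N : ℝ := ((m + 1 : ℕ) : ℝ) with hNdef
  have hN1 : (1 : ℝ) ≤ N := by rw [hNdef]; exact_mod_cast Nat.succ_le_succ (Nat.zero_le m)
  have hNpos : 0 < N := by linarith
  -- choice of the depth `σ`
  set σ : ℝ := min (1 / 3) (1 / (200 * π * K * (C + 1))) with hσdef
  have hσ0 : 0 < σ := lt_min (by norm_num) (by positivity)
  have hσ3 : σ ≤ 1 / 3 := min_le_left _ _
  have hσ1 : σ ≤ 1 := hσ3.trans (by norm_num)
  have hσC : σ ≤ 1 / (200 * π * K * (C + 1)) := min_le_right _ _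
  -- the state
  set Φ := slabState m hL hσ0 hσ1 with hΦ
  have hE : periodicEnergy 0 Φ ≤ periodicGroundStateEnergy 0 (m + 1) L + δ := by
    rw [periodicGroundStateEnergy_zero m hL, zero_add]
    refine (periodicEnergy_slabState_le hL hσ0 hσ1 hK).trans ?_
    by_cases hδt : δ = ⊤
    · rw [hδt]; exact le_top
    · have hδr : 0 < δ.toReal := ENNReal.toReal_pos hδ.ne' hδt
      have hT : 16384 * π ^ 6 * K ^ 2 / δ.toReal ≤ N := by
        have := (le_max_right _ _).trans hmT
        rwa [hT₂, if_neg hδt] at this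
      rw [← ENNReal.ofReal_toReal hδt]
      apply ENNReal.ofReal_le_ofReal
      rw [← hNdef]
      have hLN : L = N / (4 * π ^ 2) := by rw [hLdef]; ring
      have e : N * (1024 * π ^ 2 * K ^ 2 / L ^ 2) = 16384 * π ^ 6 * K ^ 2 / N := by
        rw [hLN]; field_simp; ring
      rw [e, div_le_iff₀ hNpos]
      have h' := (div_le_iff₀ hδr).mp hT
      nlinarith [h']
  have hz : ∀ X, Φ.ψ X ≠ 0 := slabState_ne_zero hL hσ0 hσ1
  obtain ⟨J, hJ, hcost⟩ := hmain m hmN L hL hdens e0 e0_ne_zero hwin Φ hE hz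
  -- the cost in the form of the duality tool
  rw [norm_e0, one_pow, div_one] at hcost
  have hφpos := slabFactor_pos hL hσ0 hσ1
  have hcost' : ∫⁻ X in cellN (m + 1) L, ENNReal.ofReal ((∑ l : Fin 3, ‖J X l‖ ^ 2) *
      (bathProd (slabFactor L σ) X / slabFactor L σ (X 0) ^ 2)) ≤ ENNReal.ofReal (C * L ^ 2) := by
    rw [← fibreCost_realProd hφpos (integral_sq_slabFactor hL hσ0.le hσ1)]
    exact hcost
  have hw : ∀ X : Config (m + 1), 0 < bathProd (slabFactor L σ) X / slabFactor L σ (X 0) ^ 2 :=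
    fun X => div_pos (bathProd_pos hφpos X) (pow_pos (hφpos _) 2)
  have hwm : Measurable fun X : Config (m + 1) => bathProd (slabFactor L σ) X / slabFactor L σ (X 0) ^ 2 := by
    refine Measurable.div (Finset.measurable_prod _ fun j _ => ?_) ?_
    · exact ((continuous_slabFactor L σ).pow 2).measurable.comp (measurable_pi_apply j)
    · exact ((continuous_slabFactor L σ).pow 2).measurable.comp (measurable_pi_apply 0)
  have key := norm_pairing_sq_le hJ (contDiff_eta (σ := σ)) (eta_periodic hL.ne') hw hwm
    (by positivity) (by positivity) hcost' (lintegral_dual_le hL hσ0 hσ1 hK)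
  have low := norm_pairing_ge (m := m) hL hσ0 hσ3
  -- contradiction: (1/16)² ≤ C L² · 64π²K²σ²/L² = 64π²K²Cσ² < 1/256
  have h1 : (1 / 16 : ℝ) ^ 2 ≤ C * L ^ 2 * (64 * π ^ 2 * K ^ 2 * σ ^ 2 / L ^ 2) :=
    (pow_le_pow_left₀ (by norm_num) low 2).trans key
  have h2 : C * L ^ 2 * (64 * π ^ 2 * K ^ 2 * σ ^ 2 / L ^ 2) = 64 * π ^ 2 * K ^ 2 * C * σ ^ 2 := by
    field_simp
  rw [h2] at h1
  have h3 : σ * (200 * π * K * (C + 1)) ≤ 1 := by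
    rwa [le_div_iff₀ (by positivity)] at hσC
  have h4 : 64 * π ^ 2 * K ^ 2 * C * σ ^ 2 < (1 / 16 : ℝ) ^ 2 := by
    have h5 : (σ * (200 * π * K * (C + 1))) ^ 2 ≤ 1 := by
      have := pow_le_pow_left₀ (by positivity) h3 2; rwa [one_pow] at this
    have hC1 : C < (C + 1) ^ 2 := by nlinarith
    nlinarith [h5, hC1, Real.pi_pos, hK0, hσ0]
  linarith

/-- **Corollary (cycle-1 §G2 re-derived, now a one-liner).** (H1) cannot be dropped. [folklore] -/
theorem not_fibreConductanceWithoutMinimiser : ¬ FibreConductanceWithoutMinimiser :=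
  fun h => not_fibreConductanceNearMinimiser (fibreConductanceNearMinimiser_of_without h)

end Main

end Summit.AtomisticToContinuum.BoseEinsteinCondensation.Theorems.FibreConductance.Negative

end
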